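import Summits.QuantumFields.YangMills.Theorems.BalabanUVNodesN11NoExpansionTStepZhPinOfSolvable
import Literature.MathematicalPhysics.QuantumFieldTheory.Balaban1983to89.B14FlowStep
import Literature.MathematicalPhysics.QuantumFieldTheory.Balaban1983to89.B14SeparationOfRecord
import Literature.MathematicalPhysics.QuantumFieldTheory.Balaban1983to89.Node00.Record12BgRowHistory
import Literature.MathematicalPhysics.QuantumFieldTheory.Balaban1983to89.Node00.LargeFieldBackgroundOfRecord

/-!
# DAG node N11 — NUMERICS HYGIENE of the no-expansion 𝐓-step: the five per-level numeric rows of dag-n11-d's ZhPin-class faces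
# (`h3` cube side vs (2.13) boxes, `hR` the [B7]-collar inequality, `hε` ∕ `hε3` ∕ `hε2` the small-field threshold `ε_j` in [B7] Prop. 2's range)
# DERIVED from SCALAR inequalities on the Stage-7 numerics `θ.ν` (`M₁, M₂, r, A₀, p₀`), the block size `L`, and the run's window `]0, θ.γ]`
# (the two ★★★★★ faces of `…N11NoExpansionTStepZhPinOfSolvable` RE-KEYED on those scalars are the sequel `…N11NoExpansionTStepZhPinOfScalars`)

HEADER — WORK-UNIT METADATA.  Cell `pub-ymgap`, YM-PLAN Track A (HUMAN RULING D-0062 ∕ D-0149 width seats), seat `pub-ymgap-dag-n11-w3` (g3; WIDTH SEAT 3∕4 on NODE n11 [B14],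
director-ym №197), route `BalabanUVNodes` (v1.7 `CoPH` key), item K1⁷ `StabilityBAtRecordR13SepCoPH` = stmt-QuantumFields-20542 (helper lane `--kind proof --supports 20542
--as helper`, count-neutral).  dag-n11-d g13's hand-out WORD-ITEM1 (3) (pub-ymgap INBOX 2026-08-28T04:04:59Z: «the numerics hygiene — derive the per-level numerics from scalar
inequalities on θ.ν; S-sized»), over its p604229 `…N11NoExpansionTStepZhPinOfSolvable` (the five binders `h3 hR hε hε3 hε2` of ★★★★★
`exists_local_witness_clause_succ_of_sLaw₁₃CoPH_of_zhPin_of_solvable` ∕ `…_of_hasSect2FormAtZS_of_borelB_of_zhPin_of_solvable` ∕ ★★★ `regOn_cutSel_of_zhPin_of_solvable`),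
node00-def's `Node00/SmallFieldChiOfRecord` (`RkOfRecord` (2.5), `cubeSide` (2.17), `epsOfRecord` (2.4), `isRj_RkOfRecord`) and — REUSED BY NAME, not restated — `B14FlowStep`
(`log_inv_sq`, `log_inv_sq_mono`, `log_inv_sq_nonneg`), `B14SeparationOfRecord.one_le_RkOfRecord`, node00-def-P11's `Node00/Record12BgRowHistory` (`mul_log_inv_sq_pow_mono`: the
(2.4) profile is increasing on `]0, e^{−p₀}]`) and `Node00/LargeFieldBackgroundOfRecord.epsOfRecord_pos`.  [III] = [Balaban1988Convergent], [B7] = [Balaban1985Averaging].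

WHY THIS FILE.  After dag-n11-d g13 the no-expansion 𝐓-step of N11's (S1ᵀ) conjunct in the ZhPin class reads, besides K0's analysis rows and the record rows, FIVE PER-LEVEL NUMERIC
ROWS quantified `∀ j, 1 ≤ j → j ≤ k → …` over the run's OWN couplings `g_j = gOfRecord₁₃ … p j`: `h3` (`3·L^j M₁ ≤ L^{j+1} M₂ R_j`), `hR` (`L^j + ((d+4)L+2)·Σ_{l<j} L^l + 2 ≤
L^{j+1} M₂ R_j`), `hε` (`0 < ε_j`), `hε3` (`143·((d+4)²∕4)²·ε_j ≤ 1∕3`), `hε2` (`2ε_j ≤ 2δ_N ∕ ((d+4)L)²`), where `R_j = RkOfRecord L r g_j` is (2.5)'s `L^s ≥ (log g_j⁻²)^r` and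
`ε_j = g_j·A₀·(log g_j⁻²)^{p₀}` is (2.4).  They are NOT per-level facts: (i) `R_j ≥ 1`, so `h3` ∕ `hR` follow from the two SCALAR inequalities `3·M₁ ≤ L·M₂` and `(d+4)·L + 3 ≤ L·M₂`
(geometric sum `Σ_{l<j} L^l + 1 ≤ L^j`, `L ≥ 2`) — or, print-faithfully, since `R_j ≥ (log g_j⁻²)^r ≥ (log γ⁻²)^r` inside the window, from `3·M₁ ≤ L·M₂·(log γ⁻²)^r` and
`(d+4)L+3 ≤ L·M₂·(log γ⁻²)^r`, which hold for ANY `M₁, M₂ ≥ 1` once `γ` is small; (ii) inside a window `0 < g_j ≤ γ < 1` every `ε_j` is positive (`A₀ > 0`) and bounded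
GLOBALLY by `A₀·(2p₀)^{p₀}·e^{−p₀}` (the maximum of `x·(log x⁻²)^{p₀}` on `]0,1[`, at `log x⁻² = 2p₀` — elementary: `log t ≤ t − 1`), and, when moreover `γ ≤ e^{−p₀}` (the
profile's increasing branch), by the EDGE value `ε(γ) := γ·A₀·(log γ⁻²)^{p₀}`; hence `hε3` ∕ `hε2` follow from the same two inequalities stated ONCE, at the global constant or at
`γ`.  Net: the five rows become scalar conditions on `(θ.ν, L, θ.γ, N)` that node00-def-K0a∕K0b's witnesses can be checked against by inspection.

WHAT THIS FILE PROVES (0 `def`, 0 `sorry`, standard axioms).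
§1 SCALAR LEMMAS: ★ `mul_pow_log_inv_sq_le_global` (`x·(log x⁻²)^p ≤ e^{−p}·(2p)^p` on `]0,1[`) · `geom_sum_succ_le_pow` (`Σ_{l<j} L^l + 1 ≤ L^j`, `L ≥ 2`) · `collar_lhs_le` (the
   `hR` left side is `≤ ((d+4)L+3)·L^j`).
§2 THE TWO GEOMETRY ROWS from scalars (generic `L d M₁ M₂ R r j : ℕ`): ★ `three_side_le_cubeSide_of` (`3·M₁ ≤ L·M₂`, `1 ≤ R`) · ★ `collar_le_cubeSide_of` (`(d+4)·L + 3 ≤ L·M₂`,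
   `2 ≤ L`, `1 ≤ R`) · the PRINT-FAITHFUL `M₂`-light forms ★ `three_side_le_cubeSide_of_log` ∕ ★ `collar_le_cubeSide_of_log` (`… ≤ L·M₂·(log γ⁻²)^r` inside the window).
§3 THE THREE THRESHOLD ROWS from the window (generic `ν : Stage7Numerics`, `g : ℕ → ℝ`, `Step.InInterval γ k g`): ★★ `epsOfRecord_le_global` (`ε_j ≤ A₀·(2p₀)^{p₀}·e^{−p₀}`, `g_j < 1`)
   · ★★ `epsOfRecord_le_edge` (`ε_j ≤ ε(γ)`, `γ ≤ e^{−p₀}`) · `epsOfRecord_pos_of_window` · `epsOfRecord_le_global_of_window` · `epsOfRecord_le_edge_of_window` ·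
   `epsOfRecord_row3_of_window_global` · `epsOfRecord_row2_of_window_global` · `epsOfRecord_row3_of_window` · `epsOfRecord_row2_of_window`.
§4 IN dag-n11-d's LETTERS (`θ : Stage13HParams F N`, run `p`, `hw : Step.InInterval θ.γ k (gOfRecord₁₃ …)`; conclusions VERBATIM the five binders of p604229): `two_le_L` · ★★
   `h3_of_scalars` · ★★ `hR_of_scalars` · `h3_of_log` · `hR_of_log` · ★★ `hε_of_window` · ★★ `hε3_of_window_global` · ★★ `hε2_of_window_global` · `hε3_of_window` · `hε2_of_window`.

HONEST FRAMING.  Helper lane, count-neutral KERNEL BOOKKEEPING — real-variable inequalities and natural-number arithmetic; nothing of Bałaban ([III] ∕ [B7] ∕ [15]) is asserted; K0's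
rows (`Provisos₁₃SepCoPH`, per-cube [15]-solvability, the cube cover `hcov`), the record rows and `2 ≤ cR` stay DISPLAYED exactly as in p604229; the scalar conditions are
HYPOTHESES — whether node00-def-K0a∕K0b's numerics of record meet them is NOT claimed (K0a's `M₂ = 1` meets `3·M₁ ≤ L·M₂` only for `3M₁ ≤ L` and never `(d+4)L+3 ≤ L·M₂`; its
`γ = ½ > e^{−1}` is outside the edge form's range, the global form applies).  N11 NOT discharged; K1⁷ NOT closed; counts unmoved (typed 28∕28 · discharged 5∕27).  One finite
`𝕋⁴_{L^K}` programme at fixed `ε = L^{−K}`; R4 closes only the conditional finite-𝕋⁴ rung `BalabanLadder.UV` — NOT ℝ⁴, NOT OS, NOT a mass gap, NOT Clay.  No `sorry`, no `axiom`,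
no `def`, no `instance`, no `notation`.
Sources (SHAPE only): [III] (2.4)–(2.5) p.255, (2.13) pp.256–257, (2.17) p.257, Theorem p.245; [B7] Prop. 2 p.26 (the range the rows encode; not exercised); [Balaban1987RG1] Thm 1 p.259
(the window).
-/

noncomputable section

open scoped BigOperators

namespace Summit.QuantumFields.YangMills.Theorems.BalabanUVNodesN11NoExpansionNumerics

open Literature.MathematicalPhysics.QuantumFieldTheory.Balaban1983to89 T4Continuum Node00
open B14.Eq213MaximalDomains (side)
open B14FlowStep (log_inv_sq log_inv_sq_mono log_inv_sq_nonneg)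
open B14SeparationOfRecord (one_le_RkOfRecord)

/-! ## §1  Scalar lemmas: the global maximum of the (2.4) profile, the geometric sum, the `hR` left side -/

section Scalar

/-- **★ THE GLOBAL MAXIMUM OF THE SMALL-FIELD PROFILE**: for `0 < x < 1`, `x·(log x⁻²)^p ≤ e^{−p}·(2p)^p` (the maximum of `u ↦ u^p e^{−u∕2}` on `u > 0` is at `u = 2p`;
elementary: `p·log(u∕2p) ≤ p·(u∕2p − 1) = u∕2 − p`). [cite: Balaban1988Convergent, (2.4) p.255 (bookkeeping)] -/
theorem mul_pow_log_inv_sq_le_global {p : ℕ} {x : ℝ} (hx : 0 < x) (hx1 : x < 1) :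
    x * (Real.log (x ^ 2)⁻¹) ^ p ≤ Real.exp (-(p : ℝ)) * (2 * p) ^ p := by
  rcases Nat.eq_zero_or_pos p with rfl | hp
  · simp only [pow_zero, mul_one, CharP.cast_eq_zero, neg_zero, Real.exp_zero]; exact hx1.le
  have hp0 : (0 : ℝ) < p := by exact_mod_cast hp
  have hu0 : 0 < Real.log (x ^ 2)⁻¹ := Real.log_pos ((one_lt_inv₀ (by positivity)).mpr (pow_lt_one₀ hx.le hx1 two_ne_zero))
  set u := Real.log (x ^ 2)⁻¹ with hu_def
  have hu : u = -2 * Real.log x := log_inv_sq x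
  have hlx : Real.log x = -(u / 2) := by linarith [hu]
  have hlhs : 0 < x * u ^ p := mul_pos hx (pow_pos hu0 p)
  have hrhs : 0 < Real.exp (-(p : ℝ)) * (2 * p) ^ p := mul_pos (Real.exp_pos _) (pow_pos (by linarith) p)
  rw [← Real.log_le_log_iff hlhs hrhs, Real.log_mul hx.ne' (pow_pos hu0 p).ne', Real.log_mul (Real.exp_pos _).ne' (pow_pos (by linarith) p).ne', Real.log_pow,
    Real.log_pow, Real.log_exp, hlx]
  -- `p·(log u − log 2p) ≤ u∕2 − p`
  have h2p : (0 : ℝ) < 2 * p := by linarith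
  have h1 : Real.log u - Real.log (2 * p) ≤ u / (2 * p) - 1 := by
    rw [← Real.log_div hu0.ne' h2p.ne']
    exact Real.log_le_sub_one_of_pos (div_pos hu0 h2p)
  have h2 : (p : ℝ) * (u / (2 * p) - 1) = u / 2 - p := by
    rw [mul_sub, mul_one, mul_div_assoc', mul_comm (p : ℝ) u, mul_div_mul_right u 2 hp0.ne']
  nlinarith [mul_le_mul_of_nonneg_left h1 hp0.le, h2]

/-- **THE GEOMETRIC SUM: `Σ_{l<j} L^l + 1 ≤ L^j`** for `L ≥ 2`. [cite: Balaban1985Averaging, Prop. 2 p.26 (the collar count; bookkeeping)] -/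
theorem geom_sum_succ_le_pow {L : ℕ} (hL : 2 ≤ L) : ∀ j : ℕ, (∑ l ∈ Finset.range j, L ^ l) + 1 ≤ L ^ j := by
  intro j
  induction j with
  | zero => simp
  | succ j ih =>
    rw [Finset.sum_range_succ, pow_succ]
    calc (∑ l ∈ Finset.range j, L ^ l) + L ^ j + 1 = ((∑ l ∈ Finset.range j, L ^ l) + 1) + L ^ j := by ring
      _ ≤ L ^ j + L ^ j := Nat.add_le_add_right ih _
      _ = L ^ j * 2 := by ring
      _ ≤ L ^ j * L := Nat.mul_le_mul_left _ hL

/-- **THE `hR` LEFT SIDE IS AT MOST `((d+4)L+3)·L^j`** (`L ≥ 2`): `L^j + ((d+4)L+2)·Σ_{l<j}L^l + 2 ≤ L^j + ((d+4)L+2)·(Σ_{l<j}L^l + 1) ≤ ((d+4)L+3)·L^j`.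
[cite: Balaban1985Averaging, Prop. 2 p.26 (bookkeeping)] -/
theorem collar_lhs_le {L : ℕ} (hL : 2 ≤ L) (d j : ℕ) :
    L ^ j + ((d + 4) * L + 2) * (∑ l ∈ Finset.range j, L ^ l) + 2 ≤ ((d + 4) * L + 3) * L ^ j := by
  have hS := geom_sum_succ_le_pow hL j
  have hc : 2 ≤ (d + 4) * L + 2 := by omega
  calc L ^ j + ((d + 4) * L + 2) * (∑ l ∈ Finset.range j, L ^ l) + 2
      ≤ L ^ j + ((d + 4) * L + 2) * (∑ l ∈ Finset.range j, L ^ l) + ((d + 4) * L + 2) := by omega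
    _ = L ^ j + ((d + 4) * L + 2) * ((∑ l ∈ Finset.range j, L ^ l) + 1) := by ring
    _ ≤ L ^ j + ((d + 4) * L + 2) * L ^ j := by gcongr
    _ = ((d + 4) * L + 3) * L ^ j := by ring

end Scalar

/-! ## §2  The two geometry rows `h3` ∕ `hR` from scalars on `(L, d, M₁, M₂)` — via `R_j ≥ 1`, and print-faithfully via `R_j ≥ (log γ⁻²)^r` -/

section Geometry

/-- **★ ROW `h3` FROM `3·M₁ ≤ L·M₂`**: `3·side L M₁ j = 3·L^j·M₁ ≤ L^j·(L·M₂) ≤ L^{j+1}·M₂·R = cubeSide L M₂ R j` for any `R ≥ 1`.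
[cite: Balaban1988Convergent, (2.13) pp.256–257, (2.17) p.257 (bookkeeping)] -/
theorem three_side_le_cubeSide_of {L M₁ M₂ R : ℕ} (hM : 3 * M₁ ≤ L * M₂) (hR : 1 ≤ R) (j : ℕ) :
    3 * side L M₁ j ≤ cubeSide L M₂ R j := by
  unfold side cubeSide
  calc 3 * (L ^ j * M₁) = L ^ j * (3 * M₁) := by ring
    _ ≤ L ^ j * (L * M₂) := Nat.mul_le_mul_left _ hM
    _ = L ^ (j + 1) * M₂ * 1 := by ring
    _ ≤ L ^ (j + 1) * M₂ * R := Nat.mul_le_mul_left _ hR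

/-- **★ ROW `hR` FROM `(d+4)·L + 3 ≤ L·M₂`** (`L ≥ 2`, `R ≥ 1`): by `collar_lhs_le`, `LHS ≤ ((d+4)L+3)·L^j ≤ (L·M₂)·L^j ≤ L^{j+1}·M₂·R`.
[cite: Balaban1988Convergent, (2.17) p.257; Balaban1985Averaging, Prop. 2 p.26 (bookkeeping)] -/
theorem collar_le_cubeSide_of {L d M₂ R : ℕ} (hL : 2 ≤ L) (hM : (d + 4) * L + 3 ≤ L * M₂) (hR : 1 ≤ R) (j : ℕ) :
    L ^ j + ((d + 4) * L + 2) * (∑ l ∈ Finset.range j, L ^ l) + 2 ≤ cubeSide L M₂ R j := by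
  unfold cubeSide
  calc L ^ j + ((d + 4) * L + 2) * (∑ l ∈ Finset.range j, L ^ l) + 2
      ≤ ((d + 4) * L + 3) * L ^ j := collar_lhs_le hL d j
    _ ≤ (L * M₂) * L ^ j := Nat.mul_le_mul_right _ hM
    _ = L ^ (j + 1) * M₂ * 1 := by ring
    _ ≤ L ^ (j + 1) * M₂ * R := Nat.mul_le_mul_left _ hR

/-- `(log γ⁻²)^r ≤ R_j` along the window: `R_j ≥ (log g⁻²)^r` ((2.5), node00-def's `isRj_RkOfRecord`) and `log g⁻² ≥ log γ⁻² ≥ 0` for `0 < g ≤ γ ≤ 1`.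
[cite: Balaban1988Convergent, (2.5) p.255 (bookkeeping)] -/
theorem pow_log_edge_le_RkOfRecord {L r : ℕ} {g γ : ℝ} (hL : 2 ≤ L) (hg : 0 < g) (hgγ : g ≤ γ) (hγ1 : γ ≤ 1) :
    (Real.log (γ ^ 2)⁻¹) ^ r ≤ (RkOfRecord L r g : ℝ) := by
  obtain ⟨_, -, h, -⟩ := isRj_RkOfRecord hL r g
  exact (pow_le_pow_left₀ (log_inv_sq_nonneg (hg.trans_le hgγ) hγ1) (log_inv_sq_mono hg hgγ) r).trans h

/-- **★ ROW `h3` FROM `3·M₁ ≤ L·M₂·(log γ⁻²)^r` — THE PRINT-FAITHFUL, `M₂`-LIGHT FORM** (`R_j ≥ (log g_j⁻²)^r ≥ (log γ⁻²)^r` inside the window `0 < g ≤ γ ≤ 1`, `L ≥ 2`): for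
small `γ` the row holds for ANY `M₁, M₂ ≥ 1`. [cite: Balaban1988Convergent, (2.5) p.255, (2.13) pp.256–257, (2.17) p.257 (bookkeeping)] -/
theorem three_side_le_cubeSide_of_log {L M₁ M₂ r : ℕ} {g γ : ℝ} (hL : 2 ≤ L) (hg : 0 < g) (hgγ : g ≤ γ) (hγ1 : γ ≤ 1)
    (hM : (3 * M₁ : ℝ) ≤ L * M₂ * (Real.log (γ ^ 2)⁻¹) ^ r) (j : ℕ) :
    3 * side L M₁ j ≤ cubeSide L M₂ (RkOfRecord L r g) j := by
  have key : (3 * M₁ : ℝ) ≤ L * M₂ * (RkOfRecord L r g : ℝ) :=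
    hM.trans (mul_le_mul_of_nonneg_left (pow_log_edge_le_RkOfRecord hL hg hgγ hγ1) (by positivity))
  unfold side cubeSide
  have h : ((3 * (L ^ j * M₁) : ℕ) : ℝ) ≤ ((L ^ (j + 1) * M₂ * RkOfRecord L r g : ℕ) : ℝ) := by
    push_cast
    calc (3 : ℝ) * ((L : ℝ) ^ j * M₁) = (L : ℝ) ^ j * (3 * M₁) := by ring
      _ ≤ (L : ℝ) ^ j * (L * M₂ * RkOfRecord L r g) := mul_le_mul_of_nonneg_left key (by positivity)
      _ = (L : ℝ) ^ (j + 1) * M₂ * RkOfRecord L r g := by ring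
  exact_mod_cast h

/-- **★ ROW `hR` FROM `(d+4)·L + 3 ≤ L·M₂·(log γ⁻²)^r` — THE PRINT-FAITHFUL, `M₂`-LIGHT FORM** (window `0 < g ≤ γ ≤ 1`, `L ≥ 2`).
[cite: Balaban1988Convergent, (2.5) p.255, (2.17) p.257; Balaban1985Averaging, Prop. 2 p.26 (bookkeeping)] -/
theorem collar_le_cubeSide_of_log {L d M₂ r : ℕ} {g γ : ℝ} (hL : 2 ≤ L) (hg : 0 < g) (hgγ : g ≤ γ) (hγ1 : γ ≤ 1)
    (hM : (((d + 4) * L + 3 : ℕ) : ℝ) ≤ L * M₂ * (Real.log (γ ^ 2)⁻¹) ^ r) (j : ℕ) :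
    L ^ j + ((d + 4) * L + 2) * (∑ l ∈ Finset.range j, L ^ l) + 2 ≤ cubeSide L M₂ (RkOfRecord L r g) j := by
  have key : (((d + 4) * L + 3 : ℕ) : ℝ) ≤ L * M₂ * (RkOfRecord L r g : ℝ) :=
    hM.trans (mul_le_mul_of_nonneg_left (pow_log_edge_le_RkOfRecord hL hg hgγ hγ1) (by positivity))
  refine (collar_lhs_le hL d j).trans ?_
  unfold cubeSide
  have h : ((((d + 4) * L + 3) * L ^ j : ℕ) : ℝ) ≤ ((L ^ (j + 1) * M₂ * RkOfRecord L r g : ℕ) : ℝ) := by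
    calc ((((d + 4) * L + 3) * L ^ j : ℕ) : ℝ) = (((d + 4) * L + 3 : ℕ) : ℝ) * (L : ℝ) ^ j := by push_cast; ring
      _ ≤ ((L : ℝ) * M₂ * RkOfRecord L r g) * (L : ℝ) ^ j := mul_le_mul_of_nonneg_right key (by positivity)
      _ = ((L ^ (j + 1) * M₂ * RkOfRecord L r g : ℕ) : ℝ) := by push_cast; ring
  exact_mod_cast h

end Geometry

/-! ## §3  The three threshold rows from the window `0 < g_j ≤ γ < 1`, `A₀ > 0` — globally (`ε_j ≤ A₀(2p₀)^{p₀}e^{−p₀}`) or at the edge (`ε_j ≤ ε(γ)`, `γ ≤ e^{−p₀}`) -/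

section Threshold

variable (ν : Stage7Numerics) (g : ℕ → ℝ)

/-- **★★ `ε_j ≤ A₀·(2p₀)^{p₀}·e^{−p₀}` FOR EVERY `0 < g_j < 1`** — the γ-free bound by the profile's global maximum (§1). [cite: Balaban1988Convergent, (2.4) p.255 (bookkeeping)] -/
theorem epsOfRecord_le_global (hA : 0 ≤ ν.A₀) {j : ℕ} (hg : 0 < g j) (hg1 : g j < 1) :
    epsOfRecord ν g j ≤ ν.A₀ * ((2 * ν.p₀) ^ ν.p₀ * Real.exp (-(ν.p₀ : ℝ))) := by
  have h := mul_pow_log_inv_sq_le_global (p := ν.p₀) hg hg1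
  show g j * (ν.A₀ * (Real.log (g j ^ 2)⁻¹) ^ ν.p₀) ≤ _
  calc g j * (ν.A₀ * (Real.log (g j ^ 2)⁻¹) ^ ν.p₀) = ν.A₀ * (g j * (Real.log (g j ^ 2)⁻¹) ^ ν.p₀) := by ring
    _ ≤ ν.A₀ * (Real.exp (-(ν.p₀ : ℝ)) * (2 * ν.p₀) ^ ν.p₀) := mul_le_mul_of_nonneg_left h hA
    _ = ν.A₀ * ((2 * ν.p₀) ^ ν.p₀ * Real.exp (-(ν.p₀ : ℝ))) := by ring

/-- **★★ `ε_j ≤ ε(γ) := γ·A₀·(log γ⁻²)^{p₀}`** — THE PROFILE AT THE WINDOW'S EDGE BOUNDS EVERY `ε_j` IN THE WINDOW when `γ ≤ e^{−p₀}` (`0 < g_j ≤ γ`, `A₀ ≥ 0`; node00-def-P11's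
`mul_log_inv_sq_pow_mono`). [cite: Balaban1988Convergent, (2.4) p.255 (bookkeeping)] -/
theorem epsOfRecord_le_edge (hA : 0 ≤ ν.A₀) {γ : ℝ} (hγp : γ ≤ Real.exp (-(ν.p₀ : ℝ))) {j : ℕ} (hg : 0 < g j) (hgγ : g j ≤ γ) :
    epsOfRecord ν g j ≤ γ * (ν.A₀ * (Real.log (γ ^ 2)⁻¹) ^ ν.p₀) := by
  have h := mul_log_inv_sq_pow_mono (p₀ := ν.p₀) hg hgγ hγp
  show g j * (ν.A₀ * (Real.log (g j ^ 2)⁻¹) ^ ν.p₀) ≤ _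
  calc g j * (ν.A₀ * (Real.log (g j ^ 2)⁻¹) ^ ν.p₀) = ν.A₀ * (g j * (Real.log (g j ^ 2)⁻¹) ^ ν.p₀) := by ring
    _ ≤ ν.A₀ * (γ * (Real.log (γ ^ 2)⁻¹) ^ ν.p₀) := mul_le_mul_of_nonneg_left h hA
    _ = γ * (ν.A₀ * (Real.log (γ ^ 2)⁻¹) ^ ν.p₀) := by ring

variable {ν g}

/-- **ROW `hε` ALONG THE WINDOW**: `Step.InInterval γ k g`, `γ < 1`, `A₀ > 0` ⇒ `0 < ε_j` for every `j ≤ k` (node00-def's `epsOfRecord_pos`).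
[cite: Balaban1988Convergent, (2.4) p.255; Balaban1987RG1, Thm 1 p.259 (the window; bookkeeping)] -/
theorem epsOfRecord_pos_of_window (hA : 0 < ν.A₀) {γ : ℝ} (hγ1 : γ < 1) {k : ℕ} (hw : Step.InInterval γ k g) :
    ∀ j, 1 ≤ j → j ≤ k → 0 < epsOfRecord ν g j := fun j _ hj =>
  epsOfRecord_pos ν hA (hw j hj).1 ((hw j hj).2.trans_lt hγ1)

/-- **EVERY `ε_j` IN THE WINDOW IS BELOW THE GLOBAL CONSTANT `A₀·(2p₀)^{p₀}·e^{−p₀}`** (`Step.InInterval γ k g`, `γ < 1`, `A₀ ≥ 0`).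
[cite: Balaban1988Convergent, (2.4) p.255; Balaban1987RG1, Thm 1 p.259 (bookkeeping)] -/
theorem epsOfRecord_le_global_of_window (hA : 0 ≤ ν.A₀) {γ : ℝ} (hγ1 : γ < 1) {k : ℕ} (hw : Step.InInterval γ k g) :
    ∀ j, 1 ≤ j → j ≤ k → epsOfRecord ν g j ≤ ν.A₀ * ((2 * ν.p₀) ^ ν.p₀ * Real.exp (-(ν.p₀ : ℝ))) := fun j _ hj =>
  epsOfRecord_le_global ν g hA (hw j hj).1 ((hw j hj).2.trans_lt hγ1)

/-- **EVERY `ε_j` IN THE WINDOW IS BELOW THE EDGE VALUE `ε(γ)`** (`Step.InInterval γ k g`, `γ ≤ e^{−p₀}`, `A₀ ≥ 0`).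
[cite: Balaban1988Convergent, (2.4) p.255; Balaban1987RG1, Thm 1 p.259 (bookkeeping)] -/
theorem epsOfRecord_le_edge_of_window (hA : 0 ≤ ν.A₀) {γ : ℝ} (hγp : γ ≤ Real.exp (-(ν.p₀ : ℝ))) {k : ℕ} (hw : Step.InInterval γ k g) :
    ∀ j, 1 ≤ j → j ≤ k → epsOfRecord ν g j ≤ γ * (ν.A₀ * (Real.log (γ ^ 2)⁻¹) ^ ν.p₀) := fun j _ hj =>
  epsOfRecord_le_edge ν g hA hγp (hw j hj).1 (hw j hj).2

/-- **ROW `hε3` ALONG THE WINDOW from the inequality AT THE GLOBAL CONSTANT**: `C·(A₀(2p₀)^{p₀}e^{−p₀}) ≤ 1∕3`, `C ≥ 0`, `γ < 1` ⇒ `C·ε_j ≤ 1∕3`, `j ≤ k`.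
[cite: Balaban1988Convergent, (2.4) p.255; Balaban1985Averaging, Prop. 2 p.26 (the range; bookkeeping)] -/
theorem epsOfRecord_row3_of_window_global (hA : 0 ≤ ν.A₀) {γ : ℝ} (hγ1 : γ < 1) {k : ℕ} (hw : Step.InInterval γ k g)
    {C : ℝ} (hC : 0 ≤ C) (h3 : C * (ν.A₀ * ((2 * ν.p₀) ^ ν.p₀ * Real.exp (-(ν.p₀ : ℝ)))) ≤ 1 / 3) :
    ∀ j, 1 ≤ j → j ≤ k → C * epsOfRecord ν g j ≤ 1 / 3 := fun j hj1 hj =>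
  (mul_le_mul_of_nonneg_left (epsOfRecord_le_global_of_window hA hγ1 hw j hj1 hj) hC).trans h3

/-- **ROW `hε2` ALONG THE WINDOW from the inequality AT THE GLOBAL CONSTANT**: `2·(A₀(2p₀)^{p₀}e^{−p₀}) ≤ D`, `γ < 1` ⇒ `2·ε_j ≤ D`, `j ≤ k`.
[cite: Balaban1988Convergent, (2.4) p.255; Balaban1985Averaging, Prop. 2 p.26 (the range; bookkeeping)] -/
theorem epsOfRecord_row2_of_window_global (hA : 0 ≤ ν.A₀) {γ : ℝ} (hγ1 : γ < 1) {k : ℕ} (hw : Step.InInterval γ k g)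
    {D : ℝ} (h2 : 2 * (ν.A₀ * ((2 * ν.p₀) ^ ν.p₀ * Real.exp (-(ν.p₀ : ℝ)))) ≤ D) :
    ∀ j, 1 ≤ j → j ≤ k → 2 * epsOfRecord ν g j ≤ D := fun j hj1 hj =>
  (mul_le_mul_of_nonneg_left (epsOfRecord_le_global_of_window hA hγ1 hw j hj1 hj) zero_le_two).trans h2

/-- **ROW `hε3` ALONG THE WINDOW from the inequality AT THE EDGE `γ`**: `C·ε(γ) ≤ 1∕3` with `C ≥ 0`, `γ ≤ e^{−p₀}` ⇒ `C·ε_j ≤ 1∕3`, `j ≤ k`.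
[cite: Balaban1988Convergent, (2.4) p.255; Balaban1985Averaging, Prop. 2 p.26 (the range; bookkeeping)] -/
theorem epsOfRecord_row3_of_window (hA : 0 ≤ ν.A₀) {γ : ℝ} (hγp : γ ≤ Real.exp (-(ν.p₀ : ℝ))) {k : ℕ} (hw : Step.InInterval γ k g)
    {C : ℝ} (hC : 0 ≤ C) (h3 : C * (γ * (ν.A₀ * (Real.log (γ ^ 2)⁻¹) ^ ν.p₀)) ≤ 1 / 3) :
    ∀ j, 1 ≤ j → j ≤ k → C * epsOfRecord ν g j ≤ 1 / 3 := fun j hj1 hj =>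
  (mul_le_mul_of_nonneg_left (epsOfRecord_le_edge_of_window hA hγp hw j hj1 hj) hC).trans h3

/-- **ROW `hε2` ALONG THE WINDOW from the inequality AT THE EDGE `γ`**: `2·ε(γ) ≤ D`, `γ ≤ e^{−p₀}` ⇒ `2·ε_j ≤ D`, `j ≤ k`.
[cite: Balaban1988Convergent, (2.4) p.255; Balaban1985Averaging, Prop. 2 p.26 (the range; bookkeeping)] -/
theorem epsOfRecord_row2_of_window (hA : 0 ≤ ν.A₀) {γ : ℝ} (hγp : γ ≤ Real.exp (-(ν.p₀ : ℝ))) {k : ℕ} (hw : Step.InInterval γ k g)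
    {D : ℝ} (h2 : 2 * (γ * (ν.A₀ * (Real.log (γ ^ 2)⁻¹) ^ ν.p₀)) ≤ D) :
    ∀ j, 1 ≤ j → j ≤ k → 2 * epsOfRecord ν g j ≤ D := fun j hj1 hj =>
  (mul_le_mul_of_nonneg_left (epsOfRecord_le_edge_of_window hA hγp hw j hj1 hj) zero_le_two).trans h2

end Threshold

/-! ## §4  In dag-n11-d's letters: the five binders of p604229 from scalars on `θ.ν`, `L`, `θ.γ` and the run's window -/

section Rows

variable {F : T4Family} {N : ℕ} [NeZero N]
variable (θ : Stage13HParams F N) (p : B12.RunParams)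

/-- `L ≥ 2` for every family (`11 < L`). [cite: Balaban1987RG1, (0.1) p.251 (bookkeeping)] -/
theorem two_le_L (K : ℕ) : 2 ≤ (F.P K).L := by
  rw [T4Family.P_L]; have := F.hL11; omega

/-- **★★ ROW `h3` OF p604229 FROM `3·M₁ ≤ L·M₂`** (VERBATIM binder shape; `R_j ≥ 1`). [cite: Balaban1988Convergent, (2.13) pp.256–257, (2.17) p.257, (2.5) p.255 (bookkeeping)] -/
theorem h3_of_scalars (hM : 3 * θ.ν.M₁ ≤ (F.P p.K).L * θ.ν.M₂) (k : ℕ) :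
    ∀ j, 1 ≤ j → j ≤ k →
      3 * side (F.P p.K).L θ.ν.M₁ j ≤ cubeSide (F.P p.K).L θ.ν.M₂ (RkOfRecord (F.P p.K).L θ.ν.r (gOfRecord₁₃ F N θ.toStage13Params p j)) j :=
  fun j _ _ => three_side_le_cubeSide_of hM (one_le_RkOfRecord (by have := two_le_L (F := F) p.K; omega) _ _) j

/-- **★★ ROW `hR` OF p604229 FROM `(d+4)·L + 3 ≤ L·M₂`** (VERBATIM binder shape; `R_j ≥ 1`). [cite: Balaban1988Convergent, (2.17) p.257, (2.5) p.255; Balaban1985Averaging, Prop. 2 p.26 (bookkeeping)] -/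
theorem hR_of_scalars (hM : ((F.P p.K).d + 4) * (F.P p.K).L + 3 ≤ (F.P p.K).L * θ.ν.M₂) (k : ℕ) :
    ∀ j, 1 ≤ j → j ≤ k → (F.P p.K).L ^ j + (((F.P p.K).d + 4) * (F.P p.K).L + 2) * (∑ l ∈ Finset.range j, (F.P p.K).L ^ l) + 2 ≤
      cubeSide (F.P p.K).L θ.ν.M₂ (RkOfRecord (F.P p.K).L θ.ν.r (gOfRecord₁₃ F N θ.toStage13Params p j)) j :=
  fun j _ _ => collar_le_cubeSide_of (two_le_L (F := F) p.K) hM (one_le_RkOfRecord (by have := two_le_L (F := F) p.K; omega) _ _) j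

/-- **ROW `h3` OF p604229 FROM `3·M₁ ≤ L·M₂·(log θ.γ⁻²)^r` AND THE WINDOW** (the `M₂`-light form; `θ.γ ≤ 1`).
[cite: Balaban1988Convergent, (2.5) p.255, (2.13) pp.256–257, (2.17) p.257; Balaban1987RG1, Thm 1 p.259 (bookkeeping)] -/
theorem h3_of_log (hγ1 : θ.γ ≤ 1) (hM : (3 * θ.ν.M₁ : ℝ) ≤ (F.P p.K).L * θ.ν.M₂ * (Real.log (θ.γ ^ 2)⁻¹) ^ θ.ν.r) {k : ℕ}
    (hw : Step.InInterval θ.γ k (gOfRecord₁₃ F N θ.toStage13Params p)) :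
    ∀ j, 1 ≤ j → j ≤ k →
      3 * side (F.P p.K).L θ.ν.M₁ j ≤ cubeSide (F.P p.K).L θ.ν.M₂ (RkOfRecord (F.P p.K).L θ.ν.r (gOfRecord₁₃ F N θ.toStage13Params p j)) j :=
  fun j _ hj => three_side_le_cubeSide_of_log (two_le_L (F := F) p.K) (hw j hj).1 (hw j hj).2 hγ1 hM j

/-- **ROW `hR` OF p604229 FROM `(d+4)·L + 3 ≤ L·M₂·(log θ.γ⁻²)^r` AND THE WINDOW** (the `M₂`-light form; `θ.γ ≤ 1`).
[cite: Balaban1988Convergent, (2.5) p.255, (2.17) p.257; Balaban1985Averaging, Prop. 2 p.26; Balaban1987RG1, Thm 1 p.259 (bookkeeping)] -/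
theorem hR_of_log (hγ1 : θ.γ ≤ 1) (hM : ((((F.P p.K).d + 4) * (F.P p.K).L + 3 : ℕ) : ℝ) ≤ (F.P p.K).L * θ.ν.M₂ * (Real.log (θ.γ ^ 2)⁻¹) ^ θ.ν.r) {k : ℕ}
    (hw : Step.InInterval θ.γ k (gOfRecord₁₃ F N θ.toStage13Params p)) :
    ∀ j, 1 ≤ j → j ≤ k → (F.P p.K).L ^ j + (((F.P p.K).d + 4) * (F.P p.K).L + 2) * (∑ l ∈ Finset.range j, (F.P p.K).L ^ l) + 2 ≤
      cubeSide (F.P p.K).L θ.ν.M₂ (RkOfRecord (F.P p.K).L θ.ν.r (gOfRecord₁₃ F N θ.toStage13Params p j)) j :=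
  fun j _ hj => collar_le_cubeSide_of_log (two_le_L (F := F) p.K) (hw j hj).1 (hw j hj).2 hγ1 hM j

/-- **★★ ROW `hε` OF p604229 FROM THE WINDOW** (`A₀ > 0`, `θ.γ < 1`; VERBATIM binder shape). [cite: Balaban1988Convergent, (2.4) p.255; Balaban1987RG1, Thm 1 p.259 (bookkeeping)] -/
theorem hε_of_window (hA : 0 < θ.ν.A₀) (hγ1 : θ.γ < 1) {k : ℕ} (hw : Step.InInterval θ.γ k (gOfRecord₁₃ F N θ.toStage13Params p)) :
    ∀ j, 1 ≤ j → j ≤ k → 0 < epsOfRecord θ.ν (gOfRecord₁₃ F N θ.toStage13Params p) j :=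
  epsOfRecord_pos_of_window hA hγ1 hw

/-- **★★ ROW `hε3` OF p604229 FROM THE WINDOW AND THE INEQUALITY AT THE GLOBAL CONSTANT** (`A₀ > 0`, `θ.γ < 1`, `143·((d+4)²∕4)²·(A₀(2p₀)^{p₀}e^{−p₀}) ≤ 1∕3`;
VERBATIM binder shape). [cite: Balaban1988Convergent, (2.4) p.255; Balaban1985Averaging, Prop. 2 p.26 (bookkeeping)] -/
theorem hε3_of_window_global (hA : 0 < θ.ν.A₀) (hγ1 : θ.γ < 1) {k : ℕ} (hw : Step.InInterval θ.γ k (gOfRecord₁₃ F N θ.toStage13Params p))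
    (h3 : (143 * (((((F.P p.K).d + 4 : ℕ) : ℝ)) ^ 2 / 4) ^ 2) * (θ.ν.A₀ * ((2 * θ.ν.p₀) ^ θ.ν.p₀ * Real.exp (-(θ.ν.p₀ : ℝ)))) ≤ 1 / 3) :
    ∀ j, 1 ≤ j → j ≤ k → (143 * (((((F.P p.K).d + 4 : ℕ) : ℝ)) ^ 2 / 4) ^ 2) * epsOfRecord θ.ν (gOfRecord₁₃ F N θ.toStage13Params p) j ≤ 1 / 3 :=
  epsOfRecord_row3_of_window_global hA.le hγ1 hw (by positivity) h3

/-- **★★ ROW `hε2` OF p604229 FROM THE WINDOW AND THE INEQUALITY AT THE GLOBAL CONSTANT** (`A₀ > 0`, `θ.γ < 1`, `2·(A₀(2p₀)^{p₀}e^{−p₀}) ≤ 2δ_N∕((d+4)L)²`; VERBATIM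
binder shape). [cite: Balaban1988Convergent, (2.4) p.255; Balaban1985Averaging, Prop. 2 p.26 (bookkeeping)] -/
theorem hε2_of_window_global (hA : 0 < θ.ν.A₀) (hγ1 : θ.γ < 1) {k : ℕ} (hw : Step.InInterval θ.γ k (gOfRecord₁₃ F N θ.toStage13Params p))
    (h2 : 2 * (θ.ν.A₀ * ((2 * θ.ν.p₀) ^ θ.ν.p₀ * Real.exp (-(θ.ν.p₀ : ℝ)))) ≤ 2 * ExpMeanLog.deltaSU (Fin N) / ((((F.P p.K).d + 4) * (F.P p.K).L : ℕ) : ℝ) ^ 2) :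
    ∀ j, 1 ≤ j → j ≤ k →
      2 * epsOfRecord θ.ν (gOfRecord₁₃ F N θ.toStage13Params p) j ≤ 2 * ExpMeanLog.deltaSU (Fin N) / ((((F.P p.K).d + 4) * (F.P p.K).L : ℕ) : ℝ) ^ 2 :=
  epsOfRecord_row2_of_window_global hA.le hγ1 hw h2

/-- **ROW `hε3` OF p604229 FROM THE WINDOW AND THE INEQUALITY AT THE EDGE `θ.γ`** (`A₀ > 0`, `θ.γ ≤ e^{−p₀}`, `143·((d+4)²∕4)²·ε(θ.γ) ≤ 1∕3`; VERBATIM binder shape).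
[cite: Balaban1988Convergent, (2.4) p.255; Balaban1985Averaging, Prop. 2 p.26 (bookkeeping)] -/
theorem hε3_of_window (hA : 0 < θ.ν.A₀) (hγp : θ.γ ≤ Real.exp (-(θ.ν.p₀ : ℝ))) {k : ℕ} (hw : Step.InInterval θ.γ k (gOfRecord₁₃ F N θ.toStage13Params p))
    (h3γ : (143 * (((((F.P p.K).d + 4 : ℕ) : ℝ)) ^ 2 / 4) ^ 2) * (θ.γ * (θ.ν.A₀ * (Real.log (θ.γ ^ 2)⁻¹) ^ θ.ν.p₀)) ≤ 1 / 3) :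
    ∀ j, 1 ≤ j → j ≤ k → (143 * (((((F.P p.K).d + 4 : ℕ) : ℝ)) ^ 2 / 4) ^ 2) * epsOfRecord θ.ν (gOfRecord₁₃ F N θ.toStage13Params p) j ≤ 1 / 3 :=
  epsOfRecord_row3_of_window hA.le hγp hw (by positivity) h3γ

/-- **ROW `hε2` OF p604229 FROM THE WINDOW AND THE INEQUALITY AT THE EDGE `θ.γ`** (`A₀ > 0`, `θ.γ ≤ e^{−p₀}`, `2ε(θ.γ) ≤ 2δ_N∕((d+4)L)²`; VERBATIM binder shape).
[cite: Balaban1988Convergent, (2.4) p.255; Balaban1985Averaging, Prop. 2 p.26 (bookkeeping)] -/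
theorem hε2_of_window (hA : 0 < θ.ν.A₀) (hγp : θ.γ ≤ Real.exp (-(θ.ν.p₀ : ℝ))) {k : ℕ} (hw : Step.InInterval θ.γ k (gOfRecord₁₃ F N θ.toStage13Params p))
    (h2γ : 2 * (θ.γ * (θ.ν.A₀ * (Real.log (θ.γ ^ 2)⁻¹) ^ θ.ν.p₀)) ≤ 2 * ExpMeanLog.deltaSU (Fin N) / ((((F.P p.K).d + 4) * (F.P p.K).L : ℕ) : ℝ) ^ 2) :
    ∀ j, 1 ≤ j → j ≤ k →
      2 * epsOfRecord θ.ν (gOfRecord₁₃ F N θ.toStage13Params p) j ≤ 2 * ExpMeanLog.deltaSU (Fin N) / ((((F.P p.K).d + 4) * (F.P p.K).L : ℕ) : ℝ) ^ 2 :=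
  epsOfRecord_row2_of_window hA.le hγp hw h2γ

end Rows

end Summit.QuantumFields.YangMills.Theorems.BalabanUVNodesN11NoExpansionNumerics

end
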